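import Summits.QuantumFields.YangMills.Theorems.BalabanUVNodesN15TwoSpacingGluingNeumannRemainderDefect
import HarnessLib

/-!
# THE GLUING STEP AT TWO LATTICE SPACINGS, XXXVI: THE TWO-GRID η-DEFECT OF THE GLUED OPERATOR OF THE COVER ON THE DOUBLED TORUS — FILE 63 ON FILE 70's COVER AT BOTH SPACINGS,
# RATE `(L^k)^{−1∕16}` FOR `L^m ≥ w₀`, modulo the one displayed images-type row (dag-n15-c g12, FILE 78; N15 = NE2, s1 «background-layer OPERATOR ingredient»)

Cell `pub-ymgap`, seat `pub-ymgap-dag-n15-c` (R134 (a); HUMAN RULING D-0062), generation 12.  `bears_on: R4∕N15 · K3⁷ SpineGivenEndpointR13SepCoPH (stmt-QuantumFields-20544)`.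
Filed `--supports stmt-QuantumFields-20544 --as helper` — COUNT-NEUTRAL.  Theorems only (0 `def`, 0 `sorry`).  Imports BY NAME FILE 77 (through it FILES 63, 69, 70, 74–76 and dag-n15-a's
PROGRAMME N); nothing in the tree is modified.

WHAT.  On the doubled torus `M = MP (paramsOf d L (m+1) k hL)` the glued operators of FILE 70 at the coarse spacing `L^{−k}` and the fine spacing `L^{−(k+r)}` (`knitGlued d L m k (L^k)`,
`knitGlued d L m k (L^r·L^k)`, SAME cubes and partition), King's pairing `P`:
* §1 ★★ `glueDefectConst_le` (FILE 63's output constant `≤ D·ε` once `N_ovθ₀c_r ≤ ½`, the fits and defects are `∝ ε`);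
* §2 ★★★ **`hasMaj_idef_knitGlued`**: GIVEN the images-type row `HY` (dag-n15-c WANT g12-4, dag-n15-a's pen), `∃ δ w₀ D > 0` (uniform in `m, k, r`) with
  `𝔇(G′_glued, G_glued) ≤ D·(L^k)^{−1∕16}·e^{−δ|y−y′|_T}` for `k ≥ 1`, `4 ≤ L^k`, `L^m ≥ w₀` — FILE 63 `hasMaj_idef_glued_of_cutRows` fed by N-IIIb (cut rows, both spacings), FILE 69 + FILE 70
  `remainderConst_le` (remainder rows `κ₀∕L^m`, both spacings), N-IIc (cut defect), FILE 77 (remainder defect), FILE 67 (partition fit), FILE 66 (overlap, cut), the smallness from `L^m ≥ w₀`.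
  With FILE 70 (iii) (`G_glued = Δ_a⁻¹` at each spacing) this is the two-grid defect of the torus propagator pair, assembled from CUBE data — the defect input of the FILE 50 socket.

HONEST FRAMING ∕ LIMITS.  Block-majorant bookkeeping over LANDED rows at `U ≡ 1` on the doubled-cube torus MODEL (cube = half torus; as an ESTIMATE of `𝔇(G′, G)` it is circular through the
torus letters that feed PROGRAMME N — what is certified is the COMPOSITION of [B6] §2's parametrix machine with [B9] Thm 3.14's difference template, every hypothesis inhabited, the guard
`L^m ≥ w₀` and the rate `(L^k)^{−1∕16}` live, one row displayed).  Nothing of [B5]∕[B6]∕[B9] asserted.  NE2⁺ NOT PRINTED, NOT proved; N15 NOT discharged; counts of record UNMOVED (typed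
28∕28 · discharged 5∕27); one finite 𝕋⁴ at fixed ε per index — NOT infinite volume, NOT OS on ℝ⁴, NOT a mass gap, NOT Clay; R4 closes the conditional finite-𝕋⁴ rung `BalabanLadder.UV`
only.  Restate-immune.
-/

noncomputable section

namespace Summit.QuantumFields.YangMills.BalabanUVNodes.N15.Gluing

open Real
open Literature.MathematicalPhysics.QuantumFieldTheory.Balaban1983to89
open Literature.MathematicalPhysics.QuantumFieldTheory.Balaban1983to89.B5Prop11Plancherel (Tor fine)
open Literature.MathematicalPhysics.QuantumFieldTheory.Balaban1983to89.B11SectG (BlockNorm HasMaj RowSum)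
open Literature.MathematicalPhysics.QuantumFieldTheory.Balaban1983to89.T4EtaRateDefect (idef)
open Literature.MathematicalPhysics.QuantumFieldTheory.Balaban1983to89.T4EtaRateCoeffDefect (pull)
open Literature.MathematicalPhysics.QuantumFieldTheory.Balaban1983to89.B6Prop26Gluing (mulOp ind ind_nonneg ind_le_one)
open Literature.MathematicalPhysics.QuantumFieldTheory.Balaban1983to89.B6UnitTorusCarrier (unitTorusGeo triangle254_unitTorusGeo rowSum_unitTorusGeo unitTorusGeo_dist_nonneg
  unitTorusGeo_dist_self)
open Literature.MathematicalPhysics.QuantumFieldTheory.Balaban1983to89.B5SiteBridgeP12 (MP)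
open Literature.MathematicalPhysics.QuantumFieldTheory.King1986.Torus (blockOf tdistT tdistT_nonneg)
open Summit.QuantumFields.YangMills.BalabanUVNodes.N15.VectorPiece (bshiftEquiv kingPrV blkFine)
open Summit.QuantumFields.YangMills.BalabanUVNodes.N15.TwoGrid (paramsOf deltaOp gOp neumannCubeG chiCube cubeBlocks landauRe qvRe qvAdjRe ineq110_114_pair hasMaj_gOp_of_ineq
  hasMaj_grad_of_ineq hasMaj_landauRe hasMaj_chiCube_symOp_comp hasMaj_comp_mulOp_chiInt hasMaj_idef_chiCube_neumannCubeG)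

variable {d : ℕ}

/-! ## §1 The compression of FILE 63's constant -/

section Small

/-- ★★ FILE 63's output constant is `≤ D·ε` once `(1 − N_ovθ₀c_r)⁻¹ ≤ 2`, `θ₀ ≤ κ₀`, the fit `o ≤ K_oε`, the cut defect `m ≤ m_cε`, the remainder defect `r ≤ C_rε`. [folklore] -/
theorem glueDefectConst_le {Nov β θ₀ κ₀ cr o Ko m mc r Cr ε : ℝ} (hNov : 0 ≤ Nov) (hβ : 0 ≤ β) (hθ₀ : 0 ≤ θ₀) (hθκ : θ₀ ≤ κ₀) (hcr : 0 ≤ cr) (hε : 0 ≤ ε) (hKo : 0 ≤ Ko)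
    (hmc : 0 ≤ mc) (ho0 : 0 ≤ o) (ho : o ≤ Ko * ε) (hr0 : 0 ≤ r) (hm : m ≤ mc * ε) (hr : r ≤ Cr * ε) (hinv0 : 0 ≤ (1 - Nov * θ₀ * cr)⁻¹)
    (hinv : (1 - Nov * θ₀ * cr)⁻¹ ≤ 2) :
    Nov * β * ((1 - Nov * θ₀ * cr)⁻¹ * ((1 - Nov * θ₀ * cr)⁻¹ * (Nov * (θ₀ * o + r)) * cr) * cr) * cr + Nov * (2 * β * o + m) * (1 - Nov * θ₀ * cr)⁻¹ * cr ≤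
      (Nov * β * (2 * (2 * (Nov * (κ₀ * Ko + Cr)) * cr) * cr) * cr + Nov * (2 * β * Ko + mc) * 2 * cr) * ε := by
  have hκ₀ : 0 ≤ κ₀ := hθ₀.trans hθκ
  calc Nov * β * ((1 - Nov * θ₀ * cr)⁻¹ * ((1 - Nov * θ₀ * cr)⁻¹ * (Nov * (θ₀ * o + r)) * cr) * cr) * cr + Nov * (2 * β * o + m) * (1 - Nov * θ₀ * cr)⁻¹ * cr
      ≤ Nov * β * (2 * (2 * (Nov * (κ₀ * (Ko * ε) + Cr * ε)) * cr) * cr) * cr + Nov * (2 * β * (Ko * ε) + mc * ε) * 2 * cr := by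
        gcongr
    _ = _ := by ring

end Small

/-! ## §2 The two-grid defect of the glued operator on the doubled torus -/

section Glued

variable {L : ℕ} [NeZero L]

/-- ★★★ **THE TWO-GRID η-DEFECT OF THE GLUED OPERATOR OF THE COVER ON THE DOUBLED TORUS, FROM CUBE DATA** (modulo the displayed images-type row `HY`): `∃ δ w₀ D > 0` (uniform in
`m, k, r`) with `𝔇(G′_glued, G_glued) ≤ D·(L^k)^{−1∕16}·e^{−δ|y−y′|_T}` whenever `k ≥ 1`, `4 ≤ L^k`, `L^m ≥ w₀` — FILE 63 `hasMaj_idef_glued_of_cutRows` with every hypothesis inhabited.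
[cite: Balaban1984PropagatorsII, (2.36)–(2.37) p.229, (2.91)–(2.93) p.239, (2.133)–(2.136) p.247 (mechanism); Balaban1985BackgroundPropagators, Thm 3.1 p.397 («M ≥ M₁»), Thm 3.14
pp.426–427 (difference template); Balaban1984PropagatorsI, (1.121)–(1.123) p.37] -/
theorem hasMaj_idef_knitGlued (hL : Odd L ∧ 1 < L) {a : ℝ} (ha : 0 < a) {δY mY : ℝ} (hδY : 0 < δY) (hmY : 0 ≤ mY)
    (HY : ∀ (m kk r : ℕ) (_hk : 1 ≤ kk) (_hn4 : 4 ≤ L ^ kk) (k : Fin (d + 1) → ZMod (2 * L)),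
        HasMaj (BlockNorm.ofBlocks (unitTorusGeo L kk (MP (paramsOf d L (m + 1) kk hL)))
            (fun b : Tor (fine (L ^ kk) (MP (paramsOf d L (m + 1) kk hL))) × Fin (d + 1) => blockOf (L ^ kk) (MP (paramsOf d L (m + 1) kk hL)) b.1))
          (BlockNorm.ofBlocks (unitTorusGeo L kk (MP (paramsOf d L (m + 1) kk hL)))
            (fun i : Tor (fine (L ^ r * L ^ kk) (MP (paramsOf d L (m + 1) kk hL))) × Fin (d + 1) => blockOf (L ^ r * L ^ kk) (MP (paramsOf d L (m + 1) kk hL)) i.1))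
          (idef (pull (kingPrV L kk r (MP (paramsOf d L (m + 1) kk hL)))) (pull (kingPrV L kk r (MP (paramsOf d L (m + 1) kk hL))))
            (mulOp (chiCube (MP (paramsOf d L (m + 1) kk hL)) (L ^ r * L ^ kk) (coverCorner (MP (paramsOf d L (m + 1) kk hL)) (L ^ m) L (coverMargin L m) k) (L * L ^ m)) ∘ₗ
              ((a • (qvAdjRe (MP (paramsOf d L (m + 1) kk hL)) (L ^ r * L ^ kk) ∘ₗ qvRe (MP (paramsOf d L (m + 1) kk hL)) (L ^ r * L ^ kk)) +
                  (-landauRe (MP (paramsOf d L (m + 1) kk hL)) (L ^ r * L ^ kk))) ∘ₗ knitG d L m kk (L ^ r * L ^ kk) hL a k))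
            (mulOp (chiCube (MP (paramsOf d L (m + 1) kk hL)) (L ^ kk) (coverCorner (MP (paramsOf d L (m + 1) kk hL)) (L ^ m) L (coverMargin L m) k) (L * L ^ m)) ∘ₗ
              ((a • (qvAdjRe (MP (paramsOf d L (m + 1) kk hL)) (L ^ kk) ∘ₗ qvRe (MP (paramsOf d L (m + 1) kk hL)) (L ^ kk)) +
                  (-landauRe (MP (paramsOf d L (m + 1) kk hL)) (L ^ kk))) ∘ₗ knitG d L m kk (L ^ kk) hL a k)))
          (fun y y' => ind ((cubeBlocks (MP (paramsOf d L (m + 1) kk hL)) (coverCorner (MP (paramsOf d L (m + 1) kk hL)) (L ^ m) L (coverMargin L m) k) (L * L ^ m) : Finset _) : Set _) y *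
            ind ((cubeBlocks (MP (paramsOf d L (m + 1) kk hL)) (coverCorner (MP (paramsOf d L (m + 1) kk hL)) (L ^ m) L (coverMargin L m) k) (L * L ^ m) : Finset _) : Set _) y' *
            (mY * ((L ^ kk : ℕ) : ℝ) ^ (-(1 / 16 : ℝ)) * Real.exp (-(δY * tdistT (MP (paramsOf d L (m + 1) kk hL)) y y'))))) :
    ∃ δ w₀ D : ℝ, 0 < δ ∧ 0 < D ∧ ∀ (m kk r : ℕ) (_hk : 1 ≤ kk) (_hn4 : 4 ≤ L ^ kk), w₀ ≤ ((L ^ m : ℕ) : ℝ) →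
      HasMaj (BlockNorm.ofBlocks (unitTorusGeo L kk (MP (paramsOf d L (m + 1) kk hL)))
          (fun b : Tor (fine (L ^ kk) (MP (paramsOf d L (m + 1) kk hL))) × Fin (d + 1) => blockOf (L ^ kk) (MP (paramsOf d L (m + 1) kk hL)) b.1))
        (BlockNorm.ofBlocks (unitTorusGeo L kk (MP (paramsOf d L (m + 1) kk hL)))
          (fun i : Tor (fine (L ^ r * L ^ kk) (MP (paramsOf d L (m + 1) kk hL))) × Fin (d + 1) => blockOf (L ^ r * L ^ kk) (MP (paramsOf d L (m + 1) kk hL)) i.1))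
        (idef (pull (kingPrV L kk r (MP (paramsOf d L (m + 1) kk hL)))) (pull (kingPrV L kk r (MP (paramsOf d L (m + 1) kk hL))))
          (knitGlued d L m kk (L ^ r * L ^ kk) hL a) (knitGlued d L m kk (L ^ kk) hL a))
        (fun y y' => D * ((L ^ kk : ℕ) : ℝ) ^ (-(1 / 16 : ℝ)) * Real.exp (-(δ * tdistT (MP (paramsOf d L (m + 1) kk hL)) y y'))) := by
  have hL3 : 3 ≤ L := by obtain ⟨⟨j, hj⟩, h1⟩ := hL; omega
  have hLpos : 0 < L := by omega
  have hLodd : Odd L := hL.1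
  have hL2 : 2 ≤ L := hL.2
  obtain ⟨δ₀, C, Cα, Cε, Cαε, hδ₀, hC, H⟩ := ineq110_114_pair (d := d) hL ha
  obtain ⟨δ₁, C₁, hδ₁, hC₁, HL⟩ := hasMaj_landauRe (d := d) (L := L)
  obtain ⟨δc, mc, hδc, hmc, HC⟩ := hasMaj_idef_chiCube_neumannCubeG (d := d) hLodd hL2 ha (γ := 1 / 8) (by norm_num) (by norm_num)
  obtain ⟨δ7, Cr, hδ7, hCr, H7⟩ := hasMaj_idef_commOp_deltaOp_comp_knitG (d := d) hL ha hδY hmY HY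
  have hδK : 0 < min δ₀ δ₁ := lt_min hδ₀ hδ₁
  set crK : ℝ := B4Sect5Proof.latticeConst (d + 1) (min δ₀ δ₁ / 4) with hcrK_def
  have hcrK : 0 ≤ crK := B4Sect5Proof.latticeConst_nonneg (d + 1) (by positivity)
  set κ₀ : ℝ := ((d + 1 : ℕ) * (32 * π ^ 2 * (2 ^ (d + 1) * (C * Real.exp δ₀)) + 2 * (π * (2 ^ (d + 1) * (C * Real.exp δ₀ * Real.exp δ₀)))) +
    2 ^ (d + 1) * ((π * (d + 1) * (Real.exp 1 * (min δ₀ δ₁ / 4))⁻¹ + 2 * (π * (d + 1))) * (|a| * (Real.exp (min δ₀ δ₁) * Real.exp (min δ₀ δ₁)) + C₁) * (C * Real.exp δ₀) * crK) +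
    (|a| * (Real.exp (min δ₀ δ₁) * Real.exp (min δ₀ δ₁)) + C₁) * (8 / min δ₀ δ₁) * (2 ^ (d + 1) * (C * Real.exp δ₀)) * crK) with hκ₀_def
  have hκ₀ : 0 ≤ κ₀ := by positivity
  set δ : ℝ := min (min δ₀ δ₁ / 2) (min δc δ7) with hδ_def
  have hδ : 0 < δ := lt_min (by positivity) (lt_min hδc hδ7)
  have hδK2 : δ ≤ min δ₀ δ₁ / 2 := min_le_left _ _
  have hδ0' : δ ≤ δ₀ := hδK2.trans (by linarith [min_le_left δ₀ δ₁])
  have hδc' : δ ≤ δc := (min_le_right _ _).trans (min_le_left _ _)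
  have hδ7' : δ ≤ δ7 := (min_le_right _ _).trans (min_le_right _ _)
  set cr : ℝ := B4Sect5Proof.latticeConst (d + 1) (δ / 4) with hcr_def
  have hcr : 0 ≤ cr := B4Sect5Proof.latticeConst_nonneg (d + 1) (by positivity)
  set Nov : ℝ := (((2 * L) ^ (d + 1) : ℕ) : ℝ) with hNov_def
  set β : ℝ := 2 ^ (d + 1) * (C * Real.exp δ₀) with hβ_def
  have hβ : 0 ≤ β := by positivity
  set D : ℝ := (Nov * β * (2 * (2 * (Nov * (κ₀ * (π * (d + 1)) + Cr)) * cr) * cr) * cr + Nov * (2 * β * (π * (d + 1)) + mc) * 2 * cr) + 1 with hD_def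
  refine ⟨δ - 2 * (δ / 4), 2 * (Nov * κ₀) * cr + 1, D, by linarith, by positivity, fun m kk r hk hn4 hw₀ => ?_⟩
  -- the index's data
  set M : Fin (d + 1) → ℕ := MP (paramsOf d L (m + 1) kk hL) with hMdef
  have hM : ∀ ν, M ν = 2 * L * L ^ m := MP_succ_eq L m kk hL
  have hM' : ∀ ν, M ν = 2 * (L * L ^ m) := fun ν => by rw [hM ν, mul_assoc]
  have hw : 0 < L ^ m := pow_pos hLpos m
  have hn : 1 ≤ L ^ kk := Nat.one_le_pow _ _ hLpos
  have hn' : 1 ≤ L ^ r * L ^ kk := Nat.one_le_iff_ne_zero.mpr (Nat.mul_ne_zero (pow_ne_zero r (NeZero.ne L)) (pow_ne_zero kk (NeZero.ne L)))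
  have hfit := coverMargin_fit hL3 m
  have hfit1 : coverMargin L m + 2 * L ^ m + 1 ≤ L * L ^ m := by omega
  have hS : L * L ^ m ≤ 2 * L * L ^ m := by rw [mul_assoc]; omega
  have hSe : L ^ (m + 1) = L * L ^ m := by rw [pow_succ, mul_comm]
  have hexp16 : (-((1 : ℝ) / 8 / 2)) = -(1 / 16 : ℝ) := by norm_num
  have hwR : (1 : ℝ) ≤ ((L ^ m : ℕ) : ℝ) := by exact_mod_cast hw
  have hwpos : (0 : ℝ) < ((L ^ m : ℕ) : ℝ) := by linarith
  have hnR : (1 : ℝ) ≤ ((L ^ kk : ℕ) : ℝ) := by exact_mod_cast hn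
  have hwm : ((L ^ m : ℕ) : ℝ) ≤ 2 * ((coverMargin L m : ℝ) + 1) := by exact_mod_cast le_two_mul_coverMargin hL3 m
  set ε : ℝ := ((L ^ kk : ℕ) : ℝ) ^ (-(1 / 16 : ℝ)) with hε_def
  obtain ⟨-, hnwε, -, hε0⟩ := rpow_sixteenth_facts hnR hwR
  have hrow := rowSum_unitTorusGeo (L := L) (k := kk) (M := M) (σ := δ / 4) (by positivity)
  have hblk : (fun i : Tor (fine (L ^ r * L ^ kk) M) × Fin (d + 1) => blockOf (L ^ r * L ^ kk) M i.1) =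
      (fun b : Tor (fine (L ^ kk) M) × Fin (d + 1) => blockOf (L ^ kk) M b.1) ∘ kingPrV L kk r M := (VectorPiece.blkFine_comp_kingPrV (M := M) L kk r).symm
  have hind : ∀ (k : Fin (d + 1) → ZMod (2 * L)) (y y' : Tor M),
      0 ≤ ind (g := unitTorusGeo L kk M) ((cubeBlocks M (coverCorner M (L ^ m) L (coverMargin L m) k) (L * L ^ m) : Finset (Tor M)) : Set (Tor M)) y *
        ind (g := unitTorusGeo L kk M) ((cubeBlocks M (coverCorner M (L ^ m) L (coverMargin L m) k) (L * L ^ m) : Finset (Tor M)) : Set (Tor M)) y' :=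
    fun k y y' => mul_nonneg (ind_nonneg _ _) (ind_nonneg _ _)
  have hind1 : ∀ (k : Fin (d + 1) → ZMod (2 * L)) (y y' : Tor M),
      0 ≤ ind (g := unitTorusGeo L kk M) ((cubeBlocks M (coverCorner M (L ^ m) L (coverMargin L m) k) (L * L ^ m) : Finset (Tor M)) : Set (Tor M)) y' :=
    fun k y y' => ind_nonneg _ _
  -- torus letters at both spacings
  have Hk := (H (m + 1) kk r hk).1
  have Hk' := (H (m + 1) kk r hk).2
  have hG := hasMaj_gOp_of_ineq (L := L) (k := kk) M (L ^ kk) a hn Hk hC.le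
  have hD := fun ν => hasMaj_grad_of_ineq (L := L) (k := kk) M (L ^ kk) a hn Hk hC.le ν
  have hG' := hasMaj_gOp_of_ineq (L := L) (k := kk) M (L ^ r * L ^ kk) a hn' Hk' hC.le
  have hD' := fun ν => hasMaj_grad_of_ineq (L := L) (k := kk) M (L ^ r * L ^ kk) a hn' Hk' hC.le ν
  have hNL := HL kk (L ^ kk) M
  have hNL' := HL kk (L ^ r * L ^ kk) M
  -- the cut rows at both spacings (rate weakened to `δ`)
  have hGc : ∀ k : Fin (d + 1) → ZMod (2 * L),
      HasMaj (BlockNorm.ofBlocks (unitTorusGeo L kk M) (fun b : Tor (fine (L ^ kk) M) × Fin (d + 1) => blockOf (L ^ kk) M b.1))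
        (BlockNorm.ofBlocks (unitTorusGeo L kk M) (fun b : Tor (fine (L ^ kk) M) × Fin (d + 1) => blockOf (L ^ kk) M b.1))
        (mulOp (chiCube M (L ^ kk) (coverCorner M (L ^ m) L (coverMargin L m) k) (L * L ^ m)) ∘ₗ knitG d L m kk (L ^ kk) hL a k)
        (fun y y' => ind ((cubeBlocks M (coverCorner M (L ^ m) L (coverMargin L m) k) (L * L ^ m) : Finset (Tor M)) : Set (Tor M)) y *
          ind ((cubeBlocks M (coverCorner M (L ^ m) L (coverMargin L m) k) (L * L ^ m) : Finset (Tor M)) : Set (Tor M)) y' * (β * Real.exp (-(δ * tdistT M y y')))) := fun k =>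
    hasMaj_rate_le (hind k) hβ hδ0'
      (hasMaj_chiCube_symOp_comp (L := L) (k := kk) (c := coverCorner M (L ^ m) L (coverMargin L m) k) (S := L * L ^ m) hC.le hδ₀.le hM'
        (hasMaj_comp_mulOp_chiInt (c := coverCorner M (L ^ m) L (coverMargin L m) k) (S := L * L ^ m) hC.le hG))
  have hGc' : ∀ k : Fin (d + 1) → ZMod (2 * L),
      HasMaj (BlockNorm.ofBlocks (unitTorusGeo L kk M) ((fun b : Tor (fine (L ^ kk) M) × Fin (d + 1) => blockOf (L ^ kk) M b.1) ∘ kingPrV L kk r M))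
        (BlockNorm.ofBlocks (unitTorusGeo L kk M) ((fun b : Tor (fine (L ^ kk) M) × Fin (d + 1) => blockOf (L ^ kk) M b.1) ∘ kingPrV L kk r M))
        (mulOp (chiCube M (L ^ r * L ^ kk) (coverCorner M (L ^ m) L (coverMargin L m) k) (L * L ^ m)) ∘ₗ knitG d L m kk (L ^ r * L ^ kk) hL a k)
        (fun y y' => ind ((cubeBlocks M (coverCorner M (L ^ m) L (coverMargin L m) k) (L * L ^ m) : Finset (Tor M)) : Set (Tor M)) y *
          ind ((cubeBlocks M (coverCorner M (L ^ m) L (coverMargin L m) k) (L * L ^ m) : Finset (Tor M)) : Set (Tor M)) y' * (β * Real.exp (-(δ * tdistT M y y')))) := fun k => by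
    rw [← hblk]
    exact hasMaj_rate_le (hind k) hβ hδ0'
      (hasMaj_chiCube_symOp_comp (L := L) (k := kk) (c := coverCorner M (L ^ m) L (coverMargin L m) k) (S := L * L ^ m) hC.le hδ₀.le hM'
        (hasMaj_comp_mulOp_chiInt (c := coverCorner M (L ^ m) L (coverMargin L m) k) (S := L * L ^ m) hC.le hG'))
  -- the remainder rows at both spacings, `θ₀ = κ₀ ∕ L^m`
  have hΘ := remainderConst_le d (a := a) hC.le hδ₀ hC₁.le hδ₁ hcrK hwR hwm
  have hK : ∀ k : Fin (d + 1) → ZMod (2 * L),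
      HasMaj (BlockNorm.ofBlocks (unitTorusGeo L kk M) (fun b : Tor (fine (L ^ kk) M) × Fin (d + 1) => blockOf (L ^ kk) M b.1))
        (BlockNorm.ofBlocks (unitTorusGeo L kk M) (fun b : Tor (fine (L ^ kk) M) × Fin (d + 1) => blockOf (L ^ kk) M b.1))
        (commOp (deltaOp M (L ^ kk) a) (knitH d L m kk (L ^ kk) hL k) ∘ₗ knitG d L m kk (L ^ kk) hL a k)
        (fun y y' => ind ((cubeBlocks M (coverCorner M (L ^ m) L (coverMargin L m) k) (L * L ^ m) : Finset (Tor M)) : Set (Tor M)) y' *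
          (κ₀ / ((L ^ m : ℕ) : ℝ) * Real.exp (-(δ * tdistT M y y')))) := fun k =>
    hasMaj_rate_le (hind1 k) (by positivity) hδK2
      ((hasMaj_commOp_deltaOp_comp_neumannCubeG (L := L) (kk := kk) hM hw hfit hC hδ₀ hC₁.le hδ₁ hG hD hNL k).mono fun y y' =>
        mul_le_mul_of_nonneg_left (mul_le_mul_of_nonneg_right hΘ (Real.exp_nonneg _)) (ind_nonneg _ _))
  have hK' : ∀ k : Fin (d + 1) → ZMod (2 * L),
      HasMaj (BlockNorm.ofBlocks (unitTorusGeo L kk M) ((fun b : Tor (fine (L ^ kk) M) × Fin (d + 1) => blockOf (L ^ kk) M b.1) ∘ kingPrV L kk r M))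
        (BlockNorm.ofBlocks (unitTorusGeo L kk M) ((fun b : Tor (fine (L ^ kk) M) × Fin (d + 1) => blockOf (L ^ kk) M b.1) ∘ kingPrV L kk r M))
        (commOp (deltaOp M (L ^ r * L ^ kk) a) (knitH d L m kk (L ^ r * L ^ kk) hL k) ∘ₗ knitG d L m kk (L ^ r * L ^ kk) hL a k)
        (fun y y' => ind ((cubeBlocks M (coverCorner M (L ^ m) L (coverMargin L m) k) (L * L ^ m) : Finset (Tor M)) : Set (Tor M)) y' *
          (κ₀ / ((L ^ m : ℕ) : ℝ) * Real.exp (-(δ * tdistT M y y')))) := fun k => by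
    rw [← hblk]
    exact hasMaj_rate_le (hind1 k) (by positivity) hδK2
      ((hasMaj_commOp_deltaOp_comp_neumannCubeG (L := L) (kk := kk) hM hw hfit hC hδ₀ hC₁.le hδ₁ hG' hD' hNL' k).mono fun y y' =>
        mul_le_mul_of_nonneg_left (mul_le_mul_of_nonneg_right hΘ (Real.exp_nonneg _)) (ind_nonneg _ _))
  -- the defects: cut (N-IIc) and remainder (FILE 77)
  have hDGc : ∀ k : Fin (d + 1) → ZMod (2 * L),
      HasMaj (BlockNorm.ofBlocks (unitTorusGeo L kk M) (fun b : Tor (fine (L ^ kk) M) × Fin (d + 1) => blockOf (L ^ kk) M b.1))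
        (BlockNorm.ofBlocks (unitTorusGeo L kk M) ((fun b : Tor (fine (L ^ kk) M) × Fin (d + 1) => blockOf (L ^ kk) M b.1) ∘ kingPrV L kk r M))
        (idef (pull (kingPrV L kk r M)) (pull (kingPrV L kk r M))
          (mulOp (chiCube M (L ^ r * L ^ kk) (coverCorner M (L ^ m) L (coverMargin L m) k) (L * L ^ m)) ∘ₗ knitG d L m kk (L ^ r * L ^ kk) hL a k)
          (mulOp (chiCube M (L ^ kk) (coverCorner M (L ^ m) L (coverMargin L m) k) (L * L ^ m)) ∘ₗ knitG d L m kk (L ^ kk) hL a k))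
        (fun y y' => ind ((cubeBlocks M (coverCorner M (L ^ m) L (coverMargin L m) k) (L * L ^ m) : Finset (Tor M)) : Set (Tor M)) y *
          ind ((cubeBlocks M (coverCorner M (L ^ m) L (coverMargin L m) k) (L * L ^ m) : Finset (Tor M)) : Set (Tor M)) y' * (mc * ε * Real.exp (-(δ * tdistT M y y')))) := fun k => by
    have h := HC (m + 1) kk r hk hL (coverCorner M (L ^ m) L (coverMargin L m) k)
    rw [hSe, hexp16] at h
    have h2 := hasMaj_rate_le (hind k) (by positivity : 0 ≤ mc * ε) hδc' h
    rw [hblk] at h2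
    exact h2
  have hDK : ∀ k : Fin (d + 1) → ZMod (2 * L),
      HasMaj (BlockNorm.ofBlocks (unitTorusGeo L kk M) (fun b : Tor (fine (L ^ kk) M) × Fin (d + 1) => blockOf (L ^ kk) M b.1))
        (BlockNorm.ofBlocks (unitTorusGeo L kk M) ((fun b : Tor (fine (L ^ kk) M) × Fin (d + 1) => blockOf (L ^ kk) M b.1) ∘ kingPrV L kk r M))
        (idef (pull (kingPrV L kk r M)) (pull (kingPrV L kk r M))
          (commOp (deltaOp M (L ^ r * L ^ kk) a) (knitH d L m kk (L ^ r * L ^ kk) hL k) ∘ₗ knitG d L m kk (L ^ r * L ^ kk) hL a k)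
          (commOp (deltaOp M (L ^ kk) a) (knitH d L m kk (L ^ kk) hL k) ∘ₗ knitG d L m kk (L ^ kk) hL a k))
        (fun y y' => ind ((cubeBlocks M (coverCorner M (L ^ m) L (coverMargin L m) k) (L * L ^ m) : Finset (Tor M)) : Set (Tor M)) y' *
          (Cr * ε * Real.exp (-(δ * tdistT M y y')))) := fun k => by
    have h := hasMaj_rate_le (hind1 k) (by positivity : 0 ≤ Cr * ε) hδ7' (H7 m kk r hk hn4 k)
    rw [hblk] at h
    exact h
  -- the partition: cuts, bounds, fit, overlap
  have hcut : ∀ k : Fin (d + 1) → ZMod (2 * L), mulOp (knitH d L m kk (L ^ kk) hL k) ∘ₗ mulOp (chiCube M (L ^ kk) (coverCorner M (L ^ m) L (coverMargin L m) k) (L * L ^ m)) =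
      mulOp (knitH d L m kk (L ^ kk) hL k) := fun k =>
    hcube_cut (2 * L) (coverXi M (L ^ kk) (L ^ m)) (bshiftEquiv M (L ^ kk)) 0 (chiCube_coverCorner_eq_one_side (M := M) (n := L ^ kk) (m₀ := coverMargin L m) hM hw hfit1 hS 0 k)
  have hcut' : ∀ k : Fin (d + 1) → ZMod (2 * L), mulOp (knitH d L m kk (L ^ r * L ^ kk) hL k) ∘ₗ mulOp (chiCube M (L ^ r * L ^ kk) (coverCorner M (L ^ m) L (coverMargin L m) k) (L * L ^ m)) =
      mulOp (knitH d L m kk (L ^ r * L ^ kk) hL k) := fun k =>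
    hcube_cut (2 * L) (coverXi M (L ^ r * L ^ kk) (L ^ m)) (bshiftEquiv M (L ^ r * L ^ kk)) 0
      (chiCube_coverCorner_eq_one_side (M := M) (n := L ^ r * L ^ kk) (m₀ := coverMargin L m) hM hw hfit1 hS 0 k)
  have hh : ∀ (k : Fin (d + 1) → ZMod (2 * L)) x, |knitH d L m kk (L ^ kk) hL k x| ≤ 1 := fun k x => abs_coverH_le_one k x
  have hh' : ∀ (k : Fin (d + 1) → ZMod (2 * L)) x', |knitH d L m kk (L ^ r * L ^ kk) hL k x'| ≤ 1 := fun k x' => abs_coverH_le_one k x'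
  have hfitH : ∀ (k : Fin (d + 1) → ZMod (2 * L)) x', |knitH d L m kk (L ^ r * L ^ kk) hL k x' - knitH d L m kk (L ^ kk) hL k (kingPrV L kk r M x')| ≤
      π * (d + 1) / (((L ^ kk : ℕ) : ℝ) * ((L ^ m : ℕ) : ℝ)) := fun k x' => abs_coverH_fine_sub_le (L := L) (kk := kk) (r := r) hM hw k x'
  have hN := fun y => sum_ind_cubeBlocks_le (M := M) (w := L ^ m) (q := L) (m₀ := coverMargin L m) L kk y
  -- the smallness
  have hMge : 2 * (Nov * κ₀) * cr ≤ ((L ^ m : ℕ) : ℝ) := by linarith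
  obtain ⟨hq, hinv⟩ := glued_smallness_of_M (cr := cr) (κ₀ := κ₀) (Nov := Nov) hwpos hMge
  -- FILE 63
  have key := hasMaj_idef_glued_of_cutRows (g := unitTorusGeo L kk M) (fun b : Tor (fine (L ^ kk) M) × Fin (d + 1) => blockOf (L ^ kk) M b.1) (kingPrV L kk r M)
    (fun k => ((cubeBlocks M (coverCorner M (L ^ m) L (coverMargin L m) k) (L * L ^ m) : Finset (Tor M)) : Set (Tor M)))
    (triangle254_unitTorusGeo L kk M) (unitTorusGeo_dist_nonneg L kk M) (unitTorusGeo_dist_self L kk M) hrow (by positivity) hcr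
    (Δ := deltaOp M (L ^ kk) a) (Δ' := deltaOp M (L ^ r * L ^ kk) a) (h := knitH d L m kk (L ^ kk) hL) (h' := knitH d L m kk (L ^ r * L ^ kk) hL)
    (G := knitG d L m kk (L ^ kk) hL a) (G' := knitG d L m kk (L ^ r * L ^ kk) hL a)
    hβ (by positivity : 0 ≤ κ₀ / ((L ^ m : ℕ) : ℝ)) (by positivity : 0 ≤ mc * ε) (by positivity : 0 ≤ Cr * ε)
    (by positivity : (0 : ℝ) ≤ π * (d + 1) / (((L ^ kk : ℕ) : ℝ) * ((L ^ m : ℕ) : ℝ))) (by positivity) (by linarith : 2 * (δ / 4) ≤ δ)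
    hcut hcut' hh hh' hfitH hN hGc hGc' hK hK' hDGc hDK hq
  rw [← hblk] at key
  refine key.mono fun y y' => mul_le_mul_of_nonneg_right ?_ (Real.exp_nonneg _)
  -- the compression
  clear key hDK hDGc hK' hK hGc' hGc hcut hcut' hh hh' hfitH hN H7 HC HY H HL hG hD hG' hD' hNL hNL' Hk Hk' hrow hblk hind hind1
  have hθκ : κ₀ / ((L ^ m : ℕ) : ℝ) ≤ κ₀ := div_le_self hκ₀ hwR
  have ho : π * (d + 1) / (((L ^ kk : ℕ) : ℝ) * ((L ^ m : ℕ) : ℝ)) ≤ π * (d + 1) * ε := by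
    rw [div_eq_mul_inv]; exact mul_le_mul_of_nonneg_left hnwε (by positivity)
  have hinv0 : 0 ≤ (1 - Nov * (κ₀ / ((L ^ m : ℕ) : ℝ)) * cr)⁻¹ := inv_nonneg.mpr (sub_nonneg.mpr hq.le)
  have hcomp := glueDefectConst_le (Ko := π * (d + 1)) (mc := mc) (Cr := Cr) (m := mc * ε) (r := Cr * ε) (by positivity : 0 ≤ Nov) hβ
    (by positivity : 0 ≤ κ₀ / ((L ^ m : ℕ) : ℝ)) hθκ hcr hε0 (by positivity) hmc.le (by positivity) ho (by positivity) (le_refl (mc * ε)) (le_refl (Cr * ε)) hinv0 hinv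
  refine hcomp.trans ?_
  rw [hD_def, add_mul _ (1 : ℝ) ε, one_mul]
  exact le_add_of_nonneg_right hε0

end Glued

end Summit.QuantumFields.YangMills.BalabanUVNodes.N15.Gluing

end
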